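import Summits.NavierStokesRegularity.NavierStokesRegularity.Theorems.StrainClockDoorsCompositions
import HarnessLib

/-!
# StrainClockDoorsCompositionsB — S38 compositions II (§5, second half: doors A2 from the plates)

P0-38 part 3 of 4: §5 from `typeIAncientSubcriticalStrain_of` (`typeIAncientSubcriticalStrain_of`, `typeIAncientStrainLaw_of`, `typeIAncientStrainLiouville_of`) of nsreg-p1 g32's `r36/Sketch38.lean` sha16 a4b540f36e6f6589 (ROUND-36 acb2d0e710b3adcc; PLATE-AID-38 §3),
every declaration byte-identical, order preserved; landed by ns-s29-p2 g4 on LEAD ns-s30-p1 g3's key 2026-08-28T20:16:56Z (g),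
`--supports stmt-NavierStokesRegularity-0056 --as helper`.

HONEST FRAME: door family S38 «StrainClockDoors» = the strain-clock criteria (forward door A0 «StrainRatioDoor»; ANCIENT /
Type-I-ancient rate-free Liouville-type doors A1/A2) about HYPOTHETICAL blow-up profiles; items 0056 `NoTypeII`, 10661 and NS
regularity are NOT proved; nothing here is a route or a summit statement.
-/

noncomputable section

open MeasureTheory Set Function Filter Metric Real InnerProductSpace
open _root_.Topology
open scoped ENNReal NNReal RealInnerProductSpace ContDiff Laplacian
open Literature.Analysis Literature.Analysis.FluidPDE
open Literature.Analysis.FluidPDE.VorticityDirectionDynamics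

set_option linter.dupNamespace false

namespace Summit.NavierStokesRegularity.NavierStokesRegularity.Theorems.StrainDoors

open Summit.NavierStokesRegularity.NavierStokesRegularity.Theorems.ArgmaxDoors

-- nested operator types (second derivatives)
set_option maxSynthPendingDepth 3
/-- **Door A2♮ from the plates**: `StrainFrameOn → StrainThresholdOn → TypeIAncientSubcriticalStrain`. The S37
two-constant log barrier of `strainFeedingDoorAlmost_of`, Step 3, on the single backward slab `[s₁,s₀]`,
`s₁ = s₀/ρ`: `Bf(s) = (C₀ + κ log(−s))/(−s)`, `C₀ = Y − κ log(−s₁)`, `Y = A + 1`, `κ = (y₀²+y₀−c)/2`,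
`ρ = e^{−(Y−y₀)/κ}`, so that `y(s) = C₀ + κ log(−s)` decreases from `Y` at `s₁` to exactly `y₀` at `s₀`;
`−Bf² + c/(−s)² ≤ Bf'` from `c + κ ≤ y + y²` (`y ≥ y₀`); growth at charged points from E1_S♭ + F_S∘ + the door
hypothesis (they lie above the line since `y ≥ y₀`) + `|u| ≤ U`; start `q(s₁) ≤ A/(−s₁) ≤ Y/(−s₁) = Bf(s₁)`. [folklore] -/
theorem typeIAncientSubcriticalStrain_of (hFr : StrainFrameOn) (hTh : StrainThresholdOn) :
    TypeIAncientSubcriticalStrain := by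
  intro ν U A y₀ c δ hν hy₀ hy₀1 hc hδ hδ1 u p hS hU hGrad hhyp s₀ hs₀ x e he
  -- WLOG `0 ≤ c`
  wlog hc0 : 0 ≤ c generalizing c with Hwlog
  · exact Hwlog (max c 0) (max_lt hc (by positivity))
      (fun s hs x e halm hbig => (hhyp s hs x e halm hbig).trans (le_max_left _ _)) (le_max_right _ _)
  have hns₀ : 0 < -s₀ := neg_pos.2 hs₀
  have hA0 : 0 ≤ A := by
    have h := (norm_nonneg _).trans (hGrad s₀ hs₀ x)
    by_contra hA
    push Not at hA
    have : A / (-s₀) < 0 := div_neg_of_neg_of_pos hA hns₀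
    linarith
  -- ### constants
  have hgap : 0 < y₀ ^ 2 + y₀ - c := by nlinarith [hc]
  set κ : ℝ := (y₀ ^ 2 + y₀ - c) / 2 with hκ
  have hκ0 : 0 < κ := by rw [hκ]; linarith [hgap]
  set Y : ℝ := A + 1 with hY
  have hYy₀ : y₀ < Y := by rw [hY]; linarith
  have hY0 : 0 < Y := hy₀.trans hYy₀
  have hquad : ∀ y : ℝ, y₀ ≤ y → c + κ ≤ y + y ^ 2 := by
    intro y hy
    have h1 : c + κ ≤ y₀ + y₀ ^ 2 := by rw [hκ]; nlinarith [hc]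
    have h2 : 0 ≤ (y - y₀) * (y + y₀ + 1) := mul_nonneg (sub_nonneg.2 hy) (by linarith)
    nlinarith
  set ρ : ℝ := Real.exp (-((Y - y₀) / κ)) with hρ
  have hρ0 : 0 < ρ := Real.exp_pos _
  have hρ1 : ρ < 1 := by
    have h : Real.exp (-((Y - y₀) / κ)) < Real.exp 0 :=
      Real.exp_lt_exp.2 (by have := div_pos (sub_pos.2 hYy₀) hκ0; linarith)
    rwa [Real.exp_zero] at h
  have hlogρ : Real.log ρ = -((Y - y₀) / κ) := by rw [hρ, Real.log_exp]
  -- ### the slab `[s₁, s₀]`, `s₁ = s₀/ρ`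
  set s₁ : ℝ := s₀ / ρ with hs₁
  have hns₁ : -s₁ = -s₀ / ρ := by rw [hs₁]; ring
  have hmul : -s₀ = -s₁ * ρ := by rw [hns₁, div_mul_cancel₀ _ hρ0.ne']
  have hlt : -s₀ < -s₁ := by
    rw [hns₁, lt_div_iff₀ hρ0]
    exact mul_lt_of_lt_one_right hns₀ hρ1
  have h10 : s₁ < s₀ := by linarith
  have hns₁pos : 0 < -s₁ := hns₀.trans hlt
  have hsol := hS s₁ s₀ h10 hs₀
  -- ### the barrier
  set C₀ : ℝ := Y - κ * Real.log (-s₁) with hC₀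
  set Bf : ℝ → ℝ := fun s => (C₀ + κ * Real.log (-s)) / (-s) with hBf
  set Bf' : ℝ → ℝ := fun s => (C₀ + κ * Real.log (-s) - κ) / (-s) ^ 2 with hBf'
  set hf : ℝ → ℝ := fun s => c / (-s) ^ 2 with hhf
  have hyend : C₀ + κ * Real.log (-s₀) = y₀ := by
    rw [hmul, Real.log_mul hns₁pos.ne' hρ0.ne', hlogρ, hC₀, mul_add, mul_neg, mul_div_cancel₀ _ hκ0.ne']
    ring
  have hyge : ∀ s ∈ Icc s₁ s₀, y₀ ≤ C₀ + κ * Real.log (-s) := by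
    intro s hs
    have hlog : Real.log (-s₀) ≤ Real.log (-s) := Real.log_le_log hns₀ (by linarith [hs.2])
    have := mul_le_mul_of_nonneg_left hlog hκ0.le
    linarith [hyend]
  have hpos : ∀ s ∈ Icc s₁ s₀, 0 < -s := fun s hs => by linarith [hs.2]
  have hBc : ContinuousOn Bf (Icc s₁ s₀) := by
    have h1 : ContinuousOn (fun s : ℝ => -s) (Icc s₁ s₀) := continuous_neg.continuousOn
    have hne : ∀ s ∈ Icc s₁ s₀, -s ≠ 0 := fun s hs => (hpos s hs).ne'
    have h2 : ContinuousOn (fun s : ℝ => C₀ + κ * Real.log (-s)) (Icc s₁ s₀) :=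
      continuousOn_const.add (continuousOn_const.mul (h1.log hne))
    exact h2.div h1 hne
  have hBpos : ∀ s ∈ Icc s₁ s₀, 0 < Bf s := fun s hs =>
    div_pos (hy₀.trans_le (hyge s hs)) (hpos s hs)
  have hBd : ∀ s ∈ Icc s₁ s₀, HasDerivWithinAt Bf (Bf' s) (Icc s₁ s₀) s := by
    intro s hs
    have hns := hpos s hs
    have hlin : HasDerivAt (fun r : ℝ => -r) (-1) s := hasDerivAt_neg' s
    have hlog : HasDerivAt (fun r : ℝ => Real.log (-r)) ((-1) / (-s)) s := hlin.log hns.ne'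
    have hnum : HasDerivAt (fun r : ℝ => C₀ + κ * Real.log (-r)) (0 + κ * ((-1) / (-s))) s :=
      (hasDerivAt_const s C₀).add (hlog.const_mul κ)
    have hquot := hnum.div hlin hns.ne'
    have hns' : -s ≠ 0 := hns.ne'
    have hs' : s ≠ 0 := fun h0 => hns' (by rw [h0, neg_zero])
    refine (hquot.congr_deriv ?_).hasDerivWithinAt
    have h3 : (0 + κ * ((-1) / (-s))) * (-s) = -κ := by
      rw [zero_add, mul_assoc, div_mul_cancel₀ _ hns', mul_neg_one]
    rw [h3]
    simp only [hBf']
    ring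
  have hsuper : ∀ s ∈ Icc s₁ s₀, -(Bf s) ^ 2 + hf s ≤ Bf' s := by
    intro s hs
    have hns := hpos s hs
    have hy := hquad _ (hyge s hs)
    simp only [hBf, hBf', hhf]
    rw [div_pow]
    have h1 : -((C₀ + κ * Real.log (-s)) ^ 2 / (-s) ^ 2) + c / (-s) ^ 2 =
        (c - (C₀ + κ * Real.log (-s)) ^ 2) / (-s) ^ 2 := by ring
    rw [h1, div_le_div_iff_of_pos_right (pow_pos hns 2)]
    linarith [hy]
  -- ### growth at the charged penalised almost-maximisers
  have hrate : ∀ ε : ℝ, 0 < ε → ε ≤ 1 → ∀ s ∈ Ioc s₁ s₀, ∀ (x e : EuclideanSpace ℝ (Fin 3)), ‖e‖ = 1 →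
      (∀ (y e' : EuclideanSpace ℝ (Fin 3)), ‖e'‖ = 1 →
        (1 + ε * ‖y‖ ^ 2)⁻¹ * strainQuad u s y e' ≤ (1 + ε * ‖x‖ ^ 2)⁻¹ * strainQuad u s x e) →
      (∀ (y e' : EuclideanSpace ℝ (Fin 3)), ‖e'‖ = 1 → (1 - δ) * strainQuad u s y e' ≤ strainQuad u s x e) →
      Bf s < strainQuad u s x e → strainRateOn (Icc s₁ s₀) u s x e ≤ -(strainQuad u s x e) ^ 2 + hf s +
        (6 * ν * ε + Real.sqrt ε * U) * strainQuad u s x e := by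
    intro ε hε _ s hs x e he hpen halm hbig
    have hsI : s ∈ Icc s₁ s₀ := ⟨hs.1.le, hs.2⟩
    have hns := hpos s hsI
    have hs0' : s < 0 := by linarith
    have hy := hyge s hsI
    have hBs := hBpos s hsI
    have hq0 : 0 < strainQuad u s x e := hBs.trans hbig
    have hline : y₀ < (-s) * strainQuad u s x e := by
      have h1 : (-s) * Bf s = C₀ + κ * Real.log (-s) := by
        simp only [hBf]
        rw [mul_div_cancel₀ _ hns.ne']
      have h2 : (-s) * Bf s < (-s) * strainQuad u s x e := mul_lt_mul_of_pos_left hbig hns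
      linarith
    have hsm : ContDiff ℝ ∞ (u s) := hsol.smooth_velocity.contDiff_slice hsI
    have heq := hFr ν s₁ s₀ h10 u p hsol s hsI x e
    have hE := strainGrowthWeighted ν ε hν.le hε (u s) (p s) hsm x e he (fun y => hpen y e he) hq0.le _ heq
    have hfeed := hhyp s hs0' x e ⟨he, halm⟩ hline
    have hfeed' : strainFeed u p s x e ≤ c / (-s) ^ 2 := by
      rw [le_div_iff₀ (pow_pos hns 2)]
      linarith [hfeed]
    have hux : ‖u s x‖ ≤ U := hU s hs0' x
    have hallow : (6 * ν * ε + Real.sqrt ε * ‖u s x‖) * strainQuad u s x e ≤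
        (6 * ν * ε + Real.sqrt ε * U) * strainQuad u s x e := by
      apply mul_le_mul_of_nonneg_right _ hq0.le
      have := mul_le_mul_of_nonneg_left hux (Real.sqrt_nonneg ε)
      linarith
    have h1 : strainRateOn (Icc s₁ s₀) u s x e ≤ -(strainQuad u s x e) ^ 2 + strainFeed u p s x e +
        (6 * ν * ε + Real.sqrt ε * ‖u s x‖) * strainQuad u s x e := by
      unfold strainRateOn strainQuad strainFeed pressureHess
      linarith [hE]
    simp only [hhf]
    linarith
  have hinit : ∀ (x e : EuclideanSpace ℝ (Fin 3)), ‖e‖ = 1 → strainQuad u s₁ x e ≤ Bf s₁ := by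
    intro y e' he'
    have h1 : Bf s₁ = Y / (-s₁) := by
      simp only [hBf, hC₀]
      ring
    rw [h1, le_div_iff₀ hns₁pos]
    have h2 : strainQuad u s₁ y e' ≤ A / (-s₁) :=
      (strainQuad_le_opNorm u s₁ y he').trans (hGrad s₁ (by linarith) y)
    rw [le_div_iff₀ hns₁pos] at h2
    rw [hY]
    nlinarith [h2, hns₁pos]
  have hKb : ∀ s ∈ Icc s₁ s₀, ∀ y : EuclideanSpace ℝ (Fin 3), ‖fderiv ℝ (u s) y‖ ≤ A / (-s₀) := by
    intro s hs y
    have hs0' : s < 0 := by linarith [hs.2]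
    exact (hGrad s hs0' y).trans (div_le_div_of_nonneg_left hA0 hns₀ (by linarith [hs.2]))
  have hmain := strainThresholdOn_riccati hTh ν s₁ s₀ δ (fun ε => 6 * ν * ε + Real.sqrt ε * U) hν h10 hδ hδ1
    (tendsto_allowance ν U) u p hsol ⟨A / (-s₀), hKb⟩ Bf Bf' hf hBc hBpos hBd hsuper
    (fun s _ => div_nonneg hc0 (sq_nonneg _)) hrate hinit s₀ ⟨h10.le, le_rfl⟩ x e he
  have h2 : Bf s₀ = y₀ / (-s₀) := by
    simp only [hBf]
    rw [hyend]
  rw [h2, le_div_iff₀ hns₀] at hmain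
  linarith [hmain]

/-- **Door A2 from A2♮ — LEAD's ancient vorticity law BY NAME** (`a := y₀ < 1`, `δ := 1/2` there; Type-I vorticity
from the Type-I gradient: `|curl v| ≤ ‖curlCLM‖·‖∇v‖`; at a vorticity almost-argmax with `ω ≠ 0`, `ξ` is a unit
vector, so A2♮ gives `⟪ξ, ∇u ξ⟫ ≤ y₀/(−s)`, and `ν|∇ξ|²_F ≥ 0`). [folklore] -/
theorem typeIAncientStrainLaw_of (h1 : TypeIAncientSubcriticalStrain) : TypeIAncientStrainLaw := by
  intro ν U A y₀ c δ hν hy₀ hy₀1 hc hδ hδ1 u p hS hU hGrad hhyp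
  have hsub := h1 ν U A y₀ c δ hν hy₀ hy₀1 hc hδ hδ1 u p hS hU hGrad hhyp
  have hTypeI : ∀ s : ℝ, s < 0 → ∀ x : EuclideanSpace ℝ (Fin 3), ‖curl (u s) x‖ ≤ (‖curlCLM‖ * A) / (-s) := by
    intro s hs x
    calc ‖curl (u s) x‖ ≤ ‖curlCLM‖ * ‖fderiv ℝ (u s) x‖ := Literature.Analysis.FluidPDE.norm_curl_le (u s) x
      _ ≤ ‖curlCLM‖ * (A / (-s)) := by
          gcongr
          exact hGrad s hs x
      _ = (‖curlCLM‖ * A) / (-s) := by ring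
  refine curl_eq_zero_of_ancient_typeI_of_almostArgmax_rate (a := y₀) (δ := 1 / 2) hν hy₀1 (by norm_num)
    hS hU hTypeI ?_
  intro s hs x₀ _ hne
  have hξ : ‖vorticityDirection (curl (u s)) x₀‖ = 1 := norm_vorticityDirection _ hne
  have hq := hsub s hs x₀ _ hξ
  have hq' : strainQuad u s x₀ (vorticityDirection (curl (u s)) x₀) ≤ y₀ / (-s) := by
    rw [le_div_iff₀ (neg_pos.2 hs)]
    linarith
  have hfrob := frobeniusNormSq_nonneg (fderiv ℝ (vorticityDirection (curl (u s))) x₀)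
  have hcomm : ⟪vorticityDirection (curl (u s)) x₀,
      fderiv ℝ (u s) x₀ (vorticityDirection (curl (u s)) x₀)⟫ =
      strainQuad u s x₀ (vorticityDirection (curl (u s)) x₀) := by
    unfold strainQuad
    exact real_inner_comm _ _
  rw [hcomm]
  nlinarith [hν.le, hfrob]

/-- **Door A2♯ from A2♮ — LEAD's `velocity_const_of_ancient_typeI_of_almostArgmax_rate` BY NAME.** [folklore] -/
theorem typeIAncientStrainLiouville_of (h1 : TypeIAncientSubcriticalStrain) : TypeIAncientStrainLiouville := by
  intro ν U A y₀ c δ hν hy₀ hy₀1 hc hδ hδ1 u p hS hU hGrad hhyp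
  have hsub := h1 ν U A y₀ c δ hν hy₀ hy₀1 hc hδ hδ1 u p hS hU hGrad hhyp
  have hTypeI : ∀ s : ℝ, s < 0 → ∀ x : EuclideanSpace ℝ (Fin 3), ‖curl (u s) x‖ ≤ (‖curlCLM‖ * A) / (-s) := by
    intro s hs x
    calc ‖curl (u s) x‖ ≤ ‖curlCLM‖ * ‖fderiv ℝ (u s) x‖ := Literature.Analysis.FluidPDE.norm_curl_le (u s) x
      _ ≤ ‖curlCLM‖ * (A / (-s)) := by
          gcongr
          exact hGrad s hs x
      _ = (‖curlCLM‖ * A) / (-s) := by ring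
  refine velocity_const_of_ancient_typeI_of_almostArgmax_rate (a := y₀) (δ := 1 / 2) hν hy₀1 (by norm_num)
    hS hU hTypeI ?_
  intro s hs x₀ _ hne
  have hξ : ‖vorticityDirection (curl (u s)) x₀‖ = 1 := norm_vorticityDirection _ hne
  have hq := hsub s hs x₀ _ hξ
  have hq' : strainQuad u s x₀ (vorticityDirection (curl (u s)) x₀) ≤ y₀ / (-s) := by
    rw [le_div_iff₀ (neg_pos.2 hs)]
    linarith
  have hfrob := frobeniusNormSq_nonneg (fderiv ℝ (vorticityDirection (curl (u s))) x₀)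
  have hcomm : ⟪vorticityDirection (curl (u s)) x₀,
      fderiv ℝ (u s) x₀ (vorticityDirection (curl (u s)) x₀)⟫ =
      strainQuad u s x₀ (vorticityDirection (curl (u s)) x₀) := by
    unfold strainQuad
    exact real_inner_comm _ _
  rw [hcomm]
  nlinarith [hν.le, hfrob]

end Summit.NavierStokesRegularity.NavierStokesRegularity.Theorems.StrainDoors

end
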